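import Summits.CriticalPhenomena.PercolationContinuityZ3.Theorems.PercGamblersRuinVerticalGamblersRuinDeterministicTimeKernel
import Summits.CriticalPhenomena.PercolationContinuityZ3.Theorems.PercGamblersRuinVerticalGamblersRuinStubNestedShiftComparison
import Summits.CriticalPhenomena.PercolationContinuityZ3.Theorems.PercGamblersRuinVerticalGamblersRuinStubReflectedComplement

/-!
# Route `PercGamblersRuin`, crux `VerticalGamblersRuin` (stmt-CriticalPhenomena-10642):
# the deterministic-time criterion (line `registered`, skeleton rev 7, lead c3)

For `K, n ≥ 1` let `S = (-Kn, (K+1)n)` (floor depth `Kn`, ceiling height `(K+1)n`), `𝒦_ω` the SRW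
averaging operator KILLED outside the open slab `(-Kn, Kn)` and `A = {x : n ≤ x₀}`; then
`(𝒦_ω^T 1_A)(0) = P^ω_0[h(X_T) ≥ n, X_0, …, X_{T-1} ∈ (-Kn,Kn)]` for the simple random walk on the open
cluster of `0`.  Write `deg_ω(0)` for the open degree of the origin and `∫` for `∫_{0↔∞} · dP_{p_c}`.

**Theorem `setIntegral_deg_killed_le` (DTC).**  For every `T` and every selection `v` of voltages of
`S` (measurable at every site): `∫ deg·(𝒦^T 1_A)(0) ≤ 2 ∫ deg·v(·,0)`.

Proof.  (a) `v(ω,0) ≥ (𝒦^T (1_A·v(ω,·)))(0)` — `v(ω,·) ≥ 0` is harmonic on the killing region, hence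
a super-fixed-point of `𝒦` (`DeterministicTime.killed_iterate_le_of_harmonic`).  (b) On `A`,
`v(ω,x) ≥ g̃(ω,x) := w(ω - x, 0)` with `w` the minimal voltage of the LOPSIDED slab `(-(K+1)n, Kn)`
(`stub_nestedShiftComparison`, superharmonic minimality `StubCoreOfVGR.minimalVoltage_superMin`).
(c) `1_A g̃ ≥ 1_A - (1 - g̃)` and `𝒦^T ≤ 𝒫^T` (unkilled) on nonnegative functions, so
`𝒦^T(1_A g̃)(0) ≥ 𝒦^T 1_A(0) - 𝒫^T(1 - g̃)(0)` (kernel algebra).  (d) STATIONARITY of the degree-biased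
cluster law under the SRW kernel: `∫ deg·𝒫^T(1 - g̃)(0) = ∫ deg·(1 - w(·,0))` (`stub_stationarity`).
(e) REFLECTION `x₀ ↦ -x₀` and a.s. Dirichlet uniqueness on the finite slab piece (BGN):
`∫ deg·w(·,0) = ∫ deg·(1 - v(·,0))` (`stub_reflectedComplement`).  Hence with `I = ∫ deg·v(·,0)`,
`J = ∫ deg·𝒦^T 1_A(0)`: `I ≥ J - ∫deg·(1 - w(·,0)) = J - ∫ deg·v(·,0) = J - I`.

**Corollary `stub_DTC` (= `VerticalGamblersRuin_of_DT`).**  The crux `PercGamblersRuin.VerticalGamblersRuin` follows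
(with `a := K`, `b := K+1`, `c/12`, `N₀ := max N 1`) from the DETERMINISTIC-TIME DISPLACEMENT statement
DT: "if `θ(p_c) > 0` there are `K ≥ 1`, `c > 0`, `N` such that for all `n ≥ N` some `T` has
`c ≤ ∫_{0↔∞} (𝒦^T_{ω,(-Kn,Kn)} 1_{n ≤ x₀})(0) dP_{p_c}`" — because `deg ≤ 6`, `deg ≥ 1` a.s. on `{0↔∞}`,
and every crux voltage dominates the minimal one.  DT is the open stub `stub_DT` of the skeleton; it is
implied by positive annealed diffusivity of the walk on the would-be critical infinite cluster
(Kipnis–Varadhan 1986 / De Masi–Ferrari–Goldstein–Wick 1989 give the diffusivity `σ² ≥ 0` θ-blind;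
`σ² > 0`, i.e. positive effective conductivity of the cluster, is what remains open at `p_c`).

## References
* C. Kipnis, S. R. S. Varadhan, Comm. Math. Phys. 104 (1986) 1–19.
* A. De Masi, P. A. Ferrari, S. Goldstein, W. D. Wick, J. Stat. Phys. 55 (1989) 787–855, §4.
* R. Lyons, Y. Peres, *Probability on Trees and Networks*, CUP (2016), §2.1.
* D. J. Barsky, G. R. Grimmett, C. M. Newman, Probab. Theory Relat. Fields 90 (1991) 111–148.
-/

noncomputable section

namespace Summit.CriticalPhenomena.PercolationContinuityZ3.Theorems.VerticalGamblersRuin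

open MeasureTheory Filter Topology
open Literature.Probability.Percolation Literature.Probability.LatticeModels
open scoped Classical

open DeterministicTime in
/-- **The deterministic-time criterion (DTC).**  For `K, n ≥ 1`, every `T : ℕ`, the SRW averaging
operator `𝒦_ω` killed outside the open slab `(-Kn, Kn)` (pinned by its formula) and every selection `v`
of voltages of the slab `(-Kn, (K+1)n)` measurable at every site:
`∫_{0↔∞} deg_ω(0)·(𝒦_ω^T 1_{n ≤ x₀})(0) dP_{p_c} ≤ 2 ∫_{0↔∞} deg_ω(0)·v(ω,0) dP_{p_c}`. -/
theorem setIntegral_deg_killed_le (K n : ℕ) (hK : 0 < K) (hn : 0 < n) (T : ℕ)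
    {Kop : BondConfig (Site 3) → (Site 3 → ℝ) → Site 3 → ℝ}
    (hKop : ∀ ω (g : Site 3 → ℝ) (x : Site 3), Kop ω g x =
      if -((K * n : ℕ) : ℤ) < x 0 ∧ x 0 < ((K * n : ℕ) : ℤ) then
        (∑ y ∈ ((zdGraph 3).neighborFinset x).filter (fun y => s(x, y) ∈ ω), g y) /
          ((((zdGraph 3).neighborFinset x).filter (fun y => s(x, y) ∈ ω)).card : ℝ)
      else 0)
    (v : BondConfig (Site 3) → Site 3 → ℝ) (hvmeas : ∀ x, Measurable fun ω => v ω x)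
    (hvsol : ∀ ω, (∀ x, 0 ≤ v ω x ∧ v ω x ≤ 1) ∧
      (∀ x : Site 3, (((K + 1) * n : ℕ) : ℤ) ≤ x 0 → v ω x = 1) ∧
      (∀ x : Site 3, x 0 ≤ -((K * n : ℕ) : ℤ) → v ω x = 0) ∧
      ∀ x : Site 3, -((K * n : ℕ) : ℤ) < x 0 → x 0 < (((K + 1) * n : ℕ) : ℤ) →
        ∑ y ∈ ((zdGraph 3).neighborFinset x).filter (fun y => s(x, y) ∈ ω), (v ω y - v ω x) = 0) :
    ∫ ω in percolatesAt (0 : Site 3),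
        ((((zdGraph 3).neighborFinset (0 : Site 3)).filter (fun y => s((0 : Site 3), y) ∈ ω)).card : ℝ) *
          ((Kop ω)^[T] (fun x => if (n : ℤ) ≤ x 0 then (1 : ℝ) else 0)) 0
        ∂(bondPercolation (zdGraph 3) (criticalProbI 3)) ≤
      2 * ∫ ω in percolatesAt (0 : Site 3),
        ((((zdGraph 3).neighborFinset (0 : Site 3)).filter (fun y => s((0 : Site 3), y) ∈ ω)).card : ℝ) *
          v ω 0 ∂(bondPercolation (zdGraph 3) (criticalProbI 3)) := by
  have hKn : 0 < K * n := Nat.mul_pos hK hn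
  set P := bondPercolation (zdGraph 3) (criticalProbI 3) with hPdef
  -- the unkilled operator, pinned by its formula
  obtain ⟨Pop, hPop⟩ : ∃ Pop : BondConfig (Site 3) → (Site 3 → ℝ) → Site 3 → ℝ,
      ∀ ω (g : Site 3 → ℝ) (x : Site 3), Pop ω g x =
        (∑ y ∈ ((zdGraph 3).neighborFinset x).filter (fun y => s(x, y) ∈ ω), g y) /
          ((((zdGraph 3).neighborFinset x).filter (fun y => s(x, y) ∈ ω)).card : ℝ) :=
    ⟨fun ω g x => (∑ y ∈ ((zdGraph 3).neighborFinset x).filter (fun y => s(x, y) ∈ ω), g y) /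
          ((((zdGraph 3).neighborFinset x).filter (fun y => s(x, y) ∈ ω)).card : ℝ), fun _ _ _ => rfl⟩
  -- the indicator `A = 1_{n ≤ x₀}` and the degree weight
  set A : Site 3 → ℝ := fun x => if (n : ℤ) ≤ x 0 then (1 : ℝ) else 0 with hAdef
  have hA : ∀ x, 0 ≤ A x ∧ A x ≤ 1 := fun x => by
    simp only [hAdef]; split_ifs <;> norm_num
  set deg : BondConfig (Site 3) → ℝ := fun ω =>
    ((((zdGraph 3).neighborFinset (0 : Site 3)).filter (fun y => s((0 : Site 3), y) ∈ ω)).card : ℝ)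
    with hdegdef
  have hdeg0 : ∀ ω, 0 ≤ deg ω := fun ω => Nat.cast_nonneg _
  have hdeg6 : ∀ ω, deg ω ≤ 6 := fun ω => deg_le_six ω 0
  -- the minimal voltage `w` of the lopsided slab `S' = (-(K+1)n, Kn)` and its shifts `gt`
  obtain ⟨w, hw_meas, hw_sol, hw_min⟩ := StubCoreOfVGR.minimalVoltage_superMin ((K + 1) * n) (K * n) hKn
  obtain ⟨gt, hgt⟩ : ∃ gt : BondConfig (Site 3) → Site 3 → ℝ,
      gt = fun ω x => w (BondConfig.relabel (sym2Equiv (Site.shift (-x))) ω) 0 := ⟨_, rfl⟩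
  have hgt_app : ∀ ω x, gt ω x = w (BondConfig.relabel (sym2Equiv (Site.shift (-x))) ω) 0 :=
    fun ω x => by rw [hgt]
  have hgt_b : ∀ ω x, 0 ≤ gt ω x ∧ gt ω x ≤ 1 := fun ω x => by
    rw [hgt_app]; exact (hw_sol _).1 0
  have hgt_meas : ∀ x, Measurable fun ω => gt ω x := fun x => by
    rw [hgt]
    exact (hw_meas 0).comp (BondConfig.relabel (sym2Equiv (Site.shift (-x)))).measurable
  -- (b) nested-slab comparison after a shift: `gt ≤ v` on `A`
  have hcmp : ∀ ω x, (n : ℤ) ≤ x 0 → gt ω x ≤ v ω x := fun ω x hx => by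
    rw [hgt_app]
    exact stub_nestedShiftComparison K n hK hn v hvsol w hw_min ω x hx
  -- (e) reflection: `∫ deg·w(0) = ∫ deg·(1 - v(0))`
  have hrefl : ∫ ω in percolatesAt (0 : Site 3), deg ω * w ω 0 ∂P =
      ∫ ω in percolatesAt (0 : Site 3), deg ω * (1 - v ω 0) ∂P :=
    stub_reflectedComplement K n hK hn v (hvmeas 0) hvsol w (hw_meas 0) hw_sol
  -- (d) stationarity with `f = 1 - w(·,0)`
  have hstat : ∫ ω in percolatesAt (0 : Site 3), deg ω * ((Pop ω)^[T] (fun x => 1 - gt ω x)) 0 ∂P =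
      ∫ ω in percolatesAt (0 : Site 3), deg ω * (1 - w ω 0) ∂P := by
    have h := stub_stationarity T (fun ω => 1 - w ω 0) (measurable_const.sub (hw_meas 0))
      (fun ω => ⟨sub_nonneg.2 ((hw_sol ω).1 0).2, by linarith [((hw_sol ω).1 0).1]⟩) Pop hPop
    simpa only [hgt] using h
  -- (a), (c): kernel algebra, pointwise in `ω`
  have k1 : ∀ ω, ((Kop ω)^[T] (fun x => A x * v ω x)) 0 ≤ v ω 0 := by
    intro ω
    refine killed_iterate_le_of_harmonic (hKop ω) (fun x => ((hvsol ω).1 x).1) (fun x hx => ?_) T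
      (fun x => ?_) 0
    · refine (hvsol ω).2.2.2 x hx.1 (lt_of_lt_of_le hx.2 ?_)
      exact_mod_cast Nat.mul_le_mul_right n (Nat.le_succ K)
    · rcases hA x with ⟨h0, h1⟩
      have := ((hvsol ω).1 x).1
      nlinarith
  have k2 : ∀ ω, ((Kop ω)^[T] (fun x => A x * gt ω x)) 0 ≤ ((Kop ω)^[T] (fun x => A x * v ω x)) 0 := by
    intro ω
    refine killed_iterate_mono (hKop ω) T (fun x => ?_) 0
    by_cases hx : (n : ℤ) ≤ x 0
    · have hA1 : A x = 1 := by simp only [hAdef, if_pos hx]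
      rw [hA1, one_mul, one_mul]
      exact hcmp ω x hx
    · have hA0 : A x = 0 := by simp only [hAdef, if_neg hx]
      rw [hA0, zero_mul, zero_mul]
  have k3 : ∀ ω, ((Kop ω)^[T] A) 0 - ((Pop ω)^[T] (fun x => 1 - gt ω x)) 0 ≤
      ((Kop ω)^[T] (fun x => A x * gt ω x)) 0 := by
    intro ω
    have hlin : ((Kop ω)^[T] fun y => A y - A y * gt ω y) =
        fun x => ((Kop ω)^[T] A) x - ((Kop ω)^[T] (fun y => A y * gt ω y)) x :=
      killed_iterate_sub (hKop ω) T A (fun y => A y * gt ω y)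
    have hle1 : ∀ x, ((Kop ω)^[T] fun y => A y - A y * gt ω y) x ≤
        ((Kop ω)^[T] fun y => 1 - gt ω y) x := by
      refine killed_iterate_mono (hKop ω) T (fun y => ?_)
      rcases hA y with ⟨h0, h1⟩
      rcases hgt_b ω y with ⟨g0, g1⟩
      nlinarith
    have hle2 : ∀ x, ((Kop ω)^[T] fun y => 1 - gt ω y) x ≤ ((Pop ω)^[T] fun y => 1 - gt ω y) x :=
      killed_iterate_le_full (hKop ω) (hPop ω) T (fun y => sub_nonneg.2 (hgt_b ω y).2)
    have h := (hle1 0).trans (hle2 0)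
    rw [hlin] at h
    linarith
  -- measurability and integrability of the bounded integrands
  have hdeg_meas : Measurable deg := StubStationarity.measurable_card_filter_zero
  have m_KA : Measurable fun ω => ((Kop ω)^[T] A) 0 :=
    measurable_killed_iterate (F := fun _ => A) (fun _ => measurable_const) hKop T 0
  have m_KAv : Measurable fun ω => ((Kop ω)^[T] (fun x => A x * v ω x)) 0 :=
    measurable_killed_iterate (F := fun ω x => A x * v ω x)
      (fun x => measurable_const.mul (hvmeas x)) hKop T 0
  have m_KAg : Measurable fun ω => ((Kop ω)^[T] (fun x => A x * gt ω x)) 0 :=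
    measurable_killed_iterate (F := fun ω x => A x * gt ω x)
      (fun x => measurable_const.mul (hgt_meas x)) hKop T 0
  have m_Pg : Measurable fun ω => ((Pop ω)^[T] (fun x => 1 - gt ω x)) 0 :=
    measurable_full_iterate (F := fun ω x => 1 - gt ω x)
      (fun x => measurable_const.sub (hgt_meas x)) hPop T 0
  have b_KA : ∀ ω, 0 ≤ ((Kop ω)^[T] A) 0 ∧ ((Kop ω)^[T] A) 0 ≤ 1 := fun ω =>
    killed_iterate_mem_Icc (hKop ω) T hA 0
  have b_KAv : ∀ ω, 0 ≤ ((Kop ω)^[T] (fun x => A x * v ω x)) 0 ∧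
      ((Kop ω)^[T] (fun x => A x * v ω x)) 0 ≤ 1 := fun ω =>
    killed_iterate_mem_Icc (hKop ω) T (fun x => by
      rcases hA x with ⟨h0, h1⟩
      rcases (hvsol ω).1 x with ⟨g0, g1⟩
      exact ⟨mul_nonneg h0 g0, by nlinarith⟩) 0
  have b_KAg : ∀ ω, 0 ≤ ((Kop ω)^[T] (fun x => A x * gt ω x)) 0 ∧
      ((Kop ω)^[T] (fun x => A x * gt ω x)) 0 ≤ 1 := fun ω =>
    killed_iterate_mem_Icc (hKop ω) T (fun x => by
      rcases hA x with ⟨h0, h1⟩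
      rcases hgt_b ω x with ⟨g0, g1⟩
      exact ⟨mul_nonneg h0 g0, by nlinarith⟩) 0
  have b_Pg : ∀ ω, 0 ≤ ((Pop ω)^[T] (fun x => 1 - gt ω x)) 0 ∧
      ((Pop ω)^[T] (fun x => 1 - gt ω x)) 0 ≤ 1 := fun ω =>
    full_iterate_mem_Icc (hPop ω) T (fun x => by
      rcases hgt_b ω x with ⟨g0, g1⟩
      exact ⟨by linarith, by linarith⟩) 0
  have hintd : ∀ X : BondConfig (Site 3) → ℝ, Measurable X → (∀ ω, 0 ≤ X ω ∧ X ω ≤ 1) →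
      Integrable (fun ω => deg ω * X ω) P := by
    intro X hX hb
    refine Integrable.of_bound (hdeg_meas.mul hX).aestronglyMeasurable 6
      (Eventually.of_forall fun ω => ?_)
    rw [Real.norm_eq_abs, abs_of_nonneg (mul_nonneg (hdeg0 ω) (hb ω).1)]
    calc deg ω * X ω ≤ 6 * 1 := mul_le_mul (hdeg6 ω) (hb ω).2 (hb ω).1 (by norm_num)
      _ = 6 := by norm_num
  have hv_b0 : ∀ ω, 0 ≤ v ω 0 ∧ v ω 0 ≤ 1 := fun ω => (hvsol ω).1 0
  have hw_b0 : ∀ ω, 0 ≤ w ω 0 ∧ w ω 0 ≤ 1 := fun ω => (hw_sol ω).1 0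
  have i_dv : Integrable (fun ω => deg ω * v ω 0) P := hintd _ (hvmeas 0) hv_b0
  have i_dw : Integrable (fun ω => deg ω * w ω 0) P := hintd _ (hw_meas 0) hw_b0
  have i_d : Integrable (fun ω => deg ω * (1 : ℝ)) P :=
    hintd (fun _ => (1 : ℝ)) measurable_const (fun _ => ⟨zero_le_one, le_rfl⟩)
  have i_dKA : Integrable (fun ω => deg ω * ((Kop ω)^[T] A) 0) P := hintd _ m_KA b_KA
  have i_dKAv : Integrable (fun ω => deg ω * ((Kop ω)^[T] (fun x => A x * v ω x)) 0) P :=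
    hintd _ m_KAv b_KAv
  have i_dKAg : Integrable (fun ω => deg ω * ((Kop ω)^[T] (fun x => A x * gt ω x)) 0) P :=
    hintd _ m_KAg b_KAg
  have i_dPg : Integrable (fun ω => deg ω * ((Pop ω)^[T] (fun x => 1 - gt ω x)) 0) P :=
    hintd _ m_Pg b_Pg
  -- the chain of integral inequalities over `{0 ↔ ∞}`
  have i1 : ∫ ω in percolatesAt (0 : Site 3), deg ω * ((Kop ω)^[T] (fun x => A x * v ω x)) 0 ∂P ≤
      ∫ ω in percolatesAt (0 : Site 3), deg ω * v ω 0 ∂P :=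
    setIntegral_mono i_dKAv.integrableOn i_dv.integrableOn
      (fun ω => mul_le_mul_of_nonneg_left (k1 ω) (hdeg0 ω))
  have i2 : ∫ ω in percolatesAt (0 : Site 3), deg ω * ((Kop ω)^[T] (fun x => A x * gt ω x)) 0 ∂P ≤
      ∫ ω in percolatesAt (0 : Site 3), deg ω * ((Kop ω)^[T] (fun x => A x * v ω x)) 0 ∂P :=
    setIntegral_mono i_dKAg.integrableOn i_dKAv.integrableOn
      (fun ω => mul_le_mul_of_nonneg_left (k2 ω) (hdeg0 ω))
  have i3 : (∫ ω in percolatesAt (0 : Site 3), deg ω * ((Kop ω)^[T] A) 0 ∂P) -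
      (∫ ω in percolatesAt (0 : Site 3), deg ω * ((Pop ω)^[T] (fun x => 1 - gt ω x)) 0 ∂P) ≤
      ∫ ω in percolatesAt (0 : Site 3), deg ω * ((Kop ω)^[T] (fun x => A x * gt ω x)) 0 ∂P := by
    rw [← integral_sub i_dKA.integrableOn i_dPg.integrableOn]
    refine setIntegral_mono (i_dKA.sub i_dPg).integrableOn i_dKAg.integrableOn (fun ω => ?_)
    have h := mul_le_mul_of_nonneg_left (k3 ω) (hdeg0 ω)
    rw [mul_sub] at h
    exact h
  have i4 : ∫ ω in percolatesAt (0 : Site 3), deg ω * ((Pop ω)^[T] (fun x => 1 - gt ω x)) 0 ∂P =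
      (∫ ω in percolatesAt (0 : Site 3), deg ω * (1 : ℝ) ∂P) -
        ∫ ω in percolatesAt (0 : Site 3), deg ω * w ω 0 ∂P := by
    rw [hstat, ← integral_sub i_d.integrableOn i_dw.integrableOn]
    exact integral_congr_ae (Eventually.of_forall fun ω => by simp only [mul_sub])
  have i5 : ∫ ω in percolatesAt (0 : Site 3), deg ω * w ω 0 ∂P =
      (∫ ω in percolatesAt (0 : Site 3), deg ω * (1 : ℝ) ∂P) -
        ∫ ω in percolatesAt (0 : Site 3), deg ω * v ω 0 ∂P := by
    rw [hrefl, ← integral_sub i_d.integrableOn i_dv.integrableOn]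
    exact integral_congr_ae (Eventually.of_forall fun ω => by simp only [mul_sub])
  linarith

open DeterministicTime in
/-- **stub `stub_DTC` of line `registered` (rev 7; exact registered signature) — the crux follows from
deterministic-time displacement (`VerticalGamblersRuin_of_DT`).**  If,
assuming `θ(p_c) > 0`, there are `K ≥ 1`, `c > 0` and `N` such that for every `n ≥ N` some
deterministic time `T` has `c ≤ ∫_{0↔∞} (𝒦^T_{ω,(-Kn,Kn)} 1_{n ≤ x₀})(0) dP_{p_c}` (the SRW on the open
cluster of `0`, killed on leaving the open slab `(-Kn, Kn)`, sits at time `T` at height `≥ n` with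
annealed probability `≥ c`), then `PercGamblersRuin.VerticalGamblersRuin` holds, with `a := K`,
`b := K + 1`, constant `c/12` and `N₀ := max N 1` (DTC for the minimal voltage, `deg ≤ 6`, `deg ≥ 1`
a.s. on `{0↔∞}`, and every voltage dominates the minimal one). -/
theorem stub_DTC :
    (0 < theta (zdGraph 3) (0 : Site 3) (criticalProbI 3) →
      ∃ K : ℕ, 0 < K ∧ ∃ c : ℝ, 0 < c ∧ ∃ N : ℕ, ∀ n ≥ N, ∃ T : ℕ,
        ∀ Kop : BondConfig (Site 3) → (Site 3 → ℝ) → Site 3 → ℝ,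
          (∀ ω (g : Site 3 → ℝ) (x : Site 3), Kop ω g x =
            if -((K * n : ℕ) : ℤ) < x 0 ∧ x 0 < ((K * n : ℕ) : ℤ) then
              (∑ y ∈ ((zdGraph 3).neighborFinset x).filter (fun y => s(x, y) ∈ ω), g y) /
                ((((zdGraph 3).neighborFinset x).filter (fun y => s(x, y) ∈ ω)).card : ℝ)
            else 0) →
          c ≤ ∫ ω in percolatesAt (0 : Site 3),
              ((Kop ω)^[T] (fun x => if (n : ℤ) ≤ x 0 then (1 : ℝ) else 0)) 0
              ∂(bondPercolation (zdGraph 3) (criticalProbI 3))) →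
    Summit.CriticalPhenomena.PercolationContinuityZ3.Theses.PercGamblersRuin.VerticalGamblersRuin := by
  intro hDT hθ
  obtain ⟨K, hK, c, hc, N, hN⟩ := hDT hθ
  refine ⟨K, K + 1, hK, Nat.lt_succ_self K, c / 12, by positivity, max N 1, ?_⟩
  intro n hn v hvmeas hvb hvt hvbot hvharm
  have hNn : N ≤ n := le_trans (le_max_left _ _) hn
  have hn0 : 0 < n := le_trans (le_max_right _ _) hn
  have hK1n : 0 < (K + 1) * n := Nat.mul_pos (Nat.succ_pos K) hn0
  set P := bondPercolation (zdGraph 3) (criticalProbI 3) with hPdef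
  -- the killed operator, pinned by its formula, and the deterministic time `T`
  obtain ⟨Kop, hKop⟩ : ∃ Kop : BondConfig (Site 3) → (Site 3 → ℝ) → Site 3 → ℝ,
      ∀ ω (g : Site 3 → ℝ) (x : Site 3), Kop ω g x =
        if -((K * n : ℕ) : ℤ) < x 0 ∧ x 0 < ((K * n : ℕ) : ℤ) then
          (∑ y ∈ ((zdGraph 3).neighborFinset x).filter (fun y => s(x, y) ∈ ω), g y) /
            ((((zdGraph 3).neighborFinset x).filter (fun y => s(x, y) ∈ ω)).card : ℝ)
        else 0 := ⟨fun ω g x =>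
        if -((K * n : ℕ) : ℤ) < x 0 ∧ x 0 < ((K * n : ℕ) : ℤ) then
          (∑ y ∈ ((zdGraph 3).neighborFinset x).filter (fun y => s(x, y) ∈ ω), g y) /
            ((((zdGraph 3).neighborFinset x).filter (fun y => s(x, y) ∈ ω)).card : ℝ)
        else 0, fun _ _ _ => rfl⟩
  obtain ⟨T, hT⟩ := hN n hNn
  have hc_le := hT Kop hKop
  set A : Site 3 → ℝ := fun x => if (n : ℤ) ≤ x 0 then (1 : ℝ) else 0 with hAdef
  have hA : ∀ x, 0 ≤ A x ∧ A x ≤ 1 := fun x => by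
    simp only [hAdef]; split_ifs <;> norm_num
  set deg : BondConfig (Site 3) → ℝ := fun ω =>
    ((((zdGraph 3).neighborFinset (0 : Site 3)).filter (fun y => s((0 : Site 3), y) ∈ ω)).card : ℝ)
    with hdegdef
  have hdeg6 : ∀ ω, deg ω ≤ 6 := fun ω => deg_le_six ω 0
  -- the minimal voltage `vS` of `S = (-Kn, (K+1)n)` lies below `v`; DTC for `vS`
  obtain ⟨vS, hvS_meas, hvS_sol, hvS_min⟩ :=
    StubCoreOfVGR.minimalVoltage_superMin (K * n) ((K + 1) * n) hK1n
  have hvS_le : ∀ ω x, vS ω x ≤ v ω x := by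
    intro ω x
    refine hvS_min ω (v ω) (fun y => (hvb ω y).1) (fun y hy => (hvt ω y hy).ge) (fun y hlo hhi => ?_) x
    exact le_of_eq (hvharm ω y hlo hhi)
  have hDTC := setIntegral_deg_killed_le K n hK hn0 T hKop vS hvS_meas hvS_sol
  -- integrability
  have hint1 : ∀ X : BondConfig (Site 3) → ℝ, Measurable X → (∀ ω, 0 ≤ X ω ∧ X ω ≤ 1) →
      Integrable X P := fun X hX hb => StubStationarity.integrable_of_bounds hX hb P
  have hvS_b0 : ∀ ω, 0 ≤ vS ω 0 ∧ vS ω 0 ≤ 1 := fun ω => (hvS_sol ω).1 0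
  have hdeg_meas : Measurable deg := StubStationarity.measurable_card_filter_zero
  have m_KA : Measurable fun ω => ((Kop ω)^[T] A) 0 :=
    measurable_killed_iterate (F := fun _ => A) (fun _ => measurable_const) hKop T 0
  have b_KA : ∀ ω, 0 ≤ ((Kop ω)^[T] A) 0 ∧ ((Kop ω)^[T] A) 0 ≤ 1 := fun ω =>
    killed_iterate_mem_Icc (hKop ω) T hA 0
  have i_v : Integrable (fun ω => v ω 0) P := hint1 _ hvmeas (fun ω => hvb ω 0)
  have i_vS : Integrable (fun ω => vS ω 0) P := hint1 _ (hvS_meas 0) hvS_b0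
  have i_KA : Integrable (fun ω => ((Kop ω)^[T] A) 0) P := hint1 _ m_KA b_KA
  have i_dvS : Integrable (fun ω => deg ω * vS ω 0) P := by
    refine Integrable.of_bound (hdeg_meas.mul (hvS_meas 0)).aestronglyMeasurable 6
      (Eventually.of_forall fun ω => ?_)
    rw [Real.norm_eq_abs, abs_of_nonneg (mul_nonneg (Nat.cast_nonneg _) (hvS_b0 ω).1)]
    calc deg ω * vS ω 0 ≤ 6 * 1 := mul_le_mul (hdeg6 ω) (hvS_b0 ω).2 (hvS_b0 ω).1 (by norm_num)
      _ = 6 := by norm_num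
  have i_dKA : Integrable (fun ω => deg ω * ((Kop ω)^[T] A) 0) P := by
    refine Integrable.of_bound (hdeg_meas.mul m_KA).aestronglyMeasurable 6
      (Eventually.of_forall fun ω => ?_)
    rw [Real.norm_eq_abs, abs_of_nonneg (mul_nonneg (Nat.cast_nonneg _) (b_KA ω).1)]
    calc deg ω * ((Kop ω)^[T] A) 0 ≤ 6 * 1 := mul_le_mul (hdeg6 ω) (b_KA ω).2 (b_KA ω).1 (by norm_num)
      _ = 6 := by norm_num
  -- `c ≤ ∫ 𝒦^T A(0) ≤ ∫ deg·𝒦^T A(0)` (deg ≥ 1 a.s. on `{0↔∞}`)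
  have hS : MeasurableSet (percolatesAt (0 : Site 3) : Set (BondConfig (Site 3))) :=
    measurableSet_percolatesAt_holds 0
  have i6 : ∫ ω in percolatesAt (0 : Site 3), ((Kop ω)^[T] A) 0 ∂P ≤
      ∫ ω in percolatesAt (0 : Site 3), deg ω * ((Kop ω)^[T] A) 0 ∂P := by
    refine setIntegral_mono_on_ae i_KA.integrableOn i_dKA.integrableOn hS ?_
    filter_upwards [one_le_deg_ae] with ω hω hmem
    have h1 : (1 : ℝ) ≤ deg ω := hω hmem
    have h0 := (b_KA ω).1
    nlinarith
  have i6' : c ≤ ∫ ω in percolatesAt (0 : Site 3), ((Kop ω)^[T] A) 0 ∂P := by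
    simpa only [hAdef] using hc_le
  -- `∫ deg·vS(0) ≤ 6 ∫ vS(0) ≤ 6 ∫ v(0)`
  have i7 : ∫ ω in percolatesAt (0 : Site 3), deg ω * vS ω 0 ∂P ≤
      6 * ∫ ω in percolatesAt (0 : Site 3), vS ω 0 ∂P := by
    rw [← integral_const_mul]
    exact setIntegral_mono i_dvS.integrableOn (i_vS.const_mul 6).integrableOn
      (fun ω => mul_le_mul_of_nonneg_right (hdeg6 ω) (hvS_b0 ω).1)
  have i8 : ∫ ω in percolatesAt (0 : Site 3), vS ω 0 ∂P ≤ ∫ ω in percolatesAt (0 : Site 3), v ω 0 ∂P :=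
    setIntegral_mono i_vS.integrableOn i_v.integrableOn (fun ω => hvS_le ω 0)
  linarith

end Summit.CriticalPhenomena.PercolationContinuityZ3.Theorems.VerticalGamblersRuin

end
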